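import Mathlib.Analysis.Complex.Basic
import Mathlib.Topology.UniformSpace.UniformConvergenceTopology
import Mathlib.Topology.MetricSpace.Thickening
import Mathlib.Topology.Sequences
import Mathlib.MeasureTheory.Integral.IntervalIntegral.Basic
import HarnessLib

/-!
# Subsequential local uniform limits of asymptotically equicontinuous families; Riemann sums

Topic `Literature/Probability/LatticeModels` (analytic glue for lattice scaling limits); an
instalment of the discharge programme for crit-ising.S18 / Smirnov's Theorem 2.2
(`Sweep1Proofs.lean`, module docstring §2b, items G2–G4). Smirnov 2010, end of §5: "the family of
functions `F_j/√δ_j` is precompact in the uniform topology on every compact subset of `Ω` …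
taking a subsequence we may assume [convergence]". The lattice observables are step functions, so
instead of Mathlib's Arzelà–Ascoli for continuous functions this file proves the extraction
directly, in the form the programme consumes; everything is elementary and `[folklore]`.

* `exists_subseq_tendstoUniformlyOn_of_asympEquicontinuous`: functions `u n : ℂ → ℂ` that are,
  on each compact `K` of the open set `D`, eventually uniformly bounded and eventually
  equicontinuous up to a vanishing scale `ε n` (`‖u n z - u n z'‖ ≤ L_K (‖z - z'‖ + ε n)`) have a
  subsequence converging uniformly on every compact of `D` to a function continuous on `D`
  (extraction on a countable dense set by compactness of a product of closed balls —
  `IsCompact.tendsto_subseq` in `ℕ → ℂ` —, then the uniform Cauchy property on compacts and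
  `UniformCauchySeqOn.tendstoUniformlyOn_of_tendsto`).
* `norm_sum_smul_sub_integral_le`: left Riemann sums, `‖∑_{k<N} h f(a+kh) - ∫_a^{a+Nh} f‖ ≤ N h ω`
  for a modulus of continuity `ω` at scale `h`; `norm_integral_sub_integral_le`.
* `tendstoLocallyUniformlyOn_of_forall_seq`: if every sequence `δ_n → 0⁺` has a subsequence along
  which `F δ_n → g` uniformly on compacts of `D`, then `F δ → g` locally uniformly on `D` along
  `𝓝[>] 0` (`Filter.eventually_iff_seq_eventually`, `Filter.extraction_of_frequently_atTop`).

## References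

* S. Smirnov, Ann. of Math. 172 (2010) 1435–1467, §5 (precompactness and passage to the limit) —
  bib key `Smirnov2010`.
-/

noncomputable section

namespace Literature.Probability.LatticeModels

open Filter Topology Metric Set

/-! ### Extraction of locally uniformly convergent subsequences -/

/-- **Asymptotic Arzelà–Ascoli on an open set of the plane (sequential form).** Let `u n : ℂ → ℂ`
be functions (no continuity assumed — in the application, lattice step functions), `D` open, and
`ε n → 0`. Suppose that on every compact `K ⊆ D` the family is eventually uniformly bounded and
eventually *equicontinuous up to the scale `ε n`*:
`‖u n z - u n z'‖ ≤ L_K (‖z - z'‖ + ε n)` for `z, z' ∈ K` and `n` large. Then a subsequence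
converges uniformly on every compact subset of `D` to a function continuous on `D`. (Diagonal
extraction on a countable dense set via compactness of a product of closed balls, then the
uniform Cauchy property on compacts.) [folklore] -/
theorem exists_subseq_tendstoUniformlyOn_of_asympEquicontinuous {D : Set ℂ} (hD : IsOpen D)
    (u : ℕ → ℂ → ℂ) (ε : ℕ → ℝ) (hε : Tendsto ε atTop (𝓝 0))
    (hbdd : ∀ K ⊆ D, IsCompact K → ∃ M : ℝ, ∀ᶠ n in atTop, ∀ z ∈ K, ‖u n z‖ ≤ M)
    (hequi : ∀ K ⊆ D, IsCompact K → ∃ L : ℝ, 0 ≤ L ∧ ∀ᶠ n in atTop, ∀ z ∈ K, ∀ z' ∈ K,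
      ‖u n z - u n z'‖ ≤ L * (‖z - z'‖ + ε n)) :
    ∃ φ : ℕ → ℕ, StrictMono φ ∧ ∃ g : ℂ → ℂ, ContinuousOn g D ∧
      ∀ K ⊆ D, IsCompact K → TendstoUniformlyOn (fun k => u (φ k)) g atTop K := by
  classical
  -- a countable dense subset of `D`, covered by the range of a sequence `q`
  obtain ⟨S, hSD, hScount, hSdense⟩ :=
    (TopologicalSpace.IsSeparable.of_separableSpace D).exists_countable_dense_subset
  obtain ⟨q, hq⟩ : ∃ q : ℕ → ℂ, S ⊆ range q := by
    rcases S.eq_empty_or_nonempty with hS | hS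
    · exact ⟨fun _ => 0, by rw [hS]; exact empty_subset _⟩
    · obtain ⟨q, hq⟩ := hScount.exists_eq_range hS
      exact ⟨q, hq.le⟩
  -- eventual bounds at the points `q j ∈ D`
  have hM : ∀ j, ∃ M : ℝ, q j ∈ D → ∀ᶠ n in atTop, ‖u n (q j)‖ ≤ M := by
    intro j
    by_cases hj : q j ∈ D
    · obtain ⟨M, hM⟩ := hbdd {q j} (singleton_subset_iff.2 hj) isCompact_singleton
      exact ⟨M, fun _ => hM.mono fun n hn => hn _ (mem_singleton _)⟩
    · exact ⟨0, fun h => absurd h hj⟩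
  choose M hM using hM
  -- truncated values: a sequence in a compact product of closed balls
  set v : ℕ → (ℕ → ℂ) := fun n j => if ‖u n (q j)‖ ≤ M j then u n (q j) else 0 with hv
  have hvmem : ∀ n, v n ∈ Set.pi univ (fun j => closedBall (0 : ℂ) (max (M j) 0)) := by
    intro n j _
    simp only [hv]
    split_ifs with h
    · rw [mem_closedBall, dist_zero_right]; exact h.trans (le_max_left _ _)
    · simp
  have hcpt : IsCompact (Set.pi univ (fun j => closedBall (0 : ℂ) (max (M j) 0))) :=
    isCompact_univ_pi fun j => isCompact_closedBall _ _
  obtain ⟨w, -, φ, hφ, hlim⟩ := hcpt.tendsto_subseq hvmem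
  have hφt : Tendsto φ atTop atTop := hφ.tendsto_atTop
  -- convergence at every `q j ∈ D`
  have hcoord : ∀ j, q j ∈ D → Tendsto (fun k => u (φ k) (q j)) atTop (𝓝 (w j)) := by
    intro j hj
    have h1 : Tendsto (fun k => v (φ k) j) atTop (𝓝 (w j)) := (tendsto_pi_nhds.1 hlim) j
    refine h1.congr' ?_
    have h3 : ∀ᶠ k in atTop, ‖u (φ k) (q j)‖ ≤ M j := hφt.eventually (hM j hj)
    exact h3.mono fun k hk => by simp [hv, hk]
  -- the uniform Cauchy property on compacts
  have hUC : ∀ K ⊆ D, IsCompact K → UniformCauchySeqOn (fun k => u (φ k)) atTop K := by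
    intro K hKD hK
    rw [Metric.uniformCauchySeqOn_iff]
    intro e he
    obtain ⟨r, hr, hrD⟩ := hK.exists_cthickening_subset_open hD hKD
    set K₁ := cthickening r K with hK₁def
    have hK₁ : IsCompact K₁ := hK.cthickening
    obtain ⟨L, hL0, hL⟩ := hequi K₁ hrD hK₁
    set ρ : ℝ := min r (e / (8 * (L + 1))) with hρ
    have hρ0 : 0 < ρ := lt_min hr (by positivity)
    have hρr : ρ ≤ r := min_le_left _ _
    have hρe : ρ ≤ e / (8 * (L + 1)) := min_le_right _ _
    obtain ⟨t, htK, htfin, hcover⟩ := finite_cover_balls_of_compact hK (half_pos hρ0)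
    have hnear : ∀ z ∈ t, ∃ j, q j ∈ D ∧ dist z (q j) < ρ / 2 := by
      intro z hz
      have hzD : z ∈ D := hKD (htK hz)
      obtain ⟨s, hsS, hsd⟩ := Metric.mem_closure_iff.1 (hSdense hzD) (ρ / 2) (half_pos hρ0)
      obtain ⟨j, rfl⟩ := hq hsS
      exact ⟨j, hSD hsS, hsd⟩
    choose! jof hjof using hnear
    -- eventual conditions, in the product filter
    have c1 : ∀ᶠ k in atTop, |ε (φ k)| < ρ := by
      have : ∀ᶠ n in atTop, |ε n| < ρ := by
        have := (Metric.tendsto_nhds.1 hε) ρ hρ0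
        simpa [Real.dist_eq] using this
      exact hφt.eventually this
    have c2 : ∀ᶠ k in atTop, ∀ z ∈ K₁, ∀ z' ∈ K₁, ‖u (φ k) z - u (φ k) z'‖ ≤ L * (‖z - z'‖ + ε (φ k)) :=
      hφt.eventually hL
    have c3 : ∀ᶠ pr in (atTop : Filter ℕ) ×ˢ (atTop : Filter ℕ), ∀ z ∈ t,
        dist (u (φ pr.1) (q (jof z))) (u (φ pr.2) (q (jof z))) < e / 4 := by
      rw [htfin.eventually_all]
      intro z hz
      have hcv := hcoord (jof z) (hjof z hz).1
      have h8 : ∀ᶠ k in atTop, dist (u (φ k) (q (jof z))) (w (jof z)) < e / 8 :=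
        (Metric.tendsto_nhds.1 hcv) (e / 8) (by positivity)
      exact (h8.prod_mk h8).mono fun pr hpr => by
        calc dist (u (φ pr.1) (q (jof z))) (u (φ pr.2) (q (jof z)))
            ≤ dist (u (φ pr.1) (q (jof z))) (w (jof z)) + dist (u (φ pr.2) (q (jof z))) (w (jof z)) :=
              dist_triangle_right _ _ _
          _ < e / 8 + e / 8 := add_lt_add hpr.1 hpr.2
          _ = e / 4 := by ring
    have call : ∀ᶠ pr in (atTop : Filter ℕ) ×ˢ (atTop : Filter ℕ),
        (|ε (φ pr.1)| < ρ ∧ ∀ z ∈ K₁, ∀ z' ∈ K₁, ‖u (φ pr.1) z - u (φ pr.1) z'‖ ≤ L * (‖z - z'‖ + ε (φ pr.1))) ∧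
        (|ε (φ pr.2)| < ρ ∧ ∀ z ∈ K₁, ∀ z' ∈ K₁, ‖u (φ pr.2) z - u (φ pr.2) z'‖ ≤ L * (‖z - z'‖ + ε (φ pr.2))) ∧
        ∀ z ∈ t, dist (u (φ pr.1) (q (jof z))) (u (φ pr.2) (q (jof z))) < e / 4 :=
      ((((c1.and c2).prod_inl atTop).and ((c1.and c2).prod_inr atTop)).and c3).mono fun pr h =>
        ⟨h.1.1, h.1.2, h.2⟩
    rw [Filter.prod_atTop_atTop_eq, Filter.eventually_atTop_prod_self'] at call
    obtain ⟨N, hN⟩ := call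
    refine ⟨N, fun m hm n hn x hx => ?_⟩
    obtain ⟨⟨hε1, hL1⟩, ⟨hε2, hL2⟩, hq12⟩ := hN m hm n hn
    -- locate `x` near a centre `z ∈ t` and its rational-like neighbour `q (jof z)`
    obtain ⟨z, hz, hxz⟩ : ∃ z ∈ t, x ∈ ball z (ρ / 2) := by simpa using hcover hx
    have hzq := (hjof z hz).2
    have hxq : dist x (q (jof z)) < ρ := by
      calc dist x (q (jof z)) ≤ dist x z + dist z (q (jof z)) := dist_triangle _ _ _
        _ < ρ / 2 + ρ / 2 := add_lt_add (mem_ball.1 hxz) hzq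
        _ = ρ := by ring
    have hxK₁ : x ∈ K₁ := self_subset_cthickening _ hx
    have hqK₁ : q (jof z) ∈ K₁ := Metric.mem_cthickening_of_dist_le _ x _ _ hx (by rw [dist_comm]; linarith)
    have e1 := hL1 x hxK₁ (q (jof z)) hqK₁
    have e2 := hL2 x hxK₁ (q (jof z)) hqK₁
    have e3 := hq12 z hz
    rw [← dist_eq_norm] at e1 e2
    have hxq' : ‖x - q (jof z)‖ < ρ := by rwa [← dist_eq_norm]
    have b1 : dist (u (φ m) x) (u (φ m) (q (jof z))) ≤ L * (2 * ρ) := by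
      refine e1.trans (mul_le_mul_of_nonneg_left ?_ hL0); linarith [le_abs_self (ε (φ m))]
    have b2 : dist (u (φ n) x) (u (φ n) (q (jof z))) ≤ L * (2 * ρ) := by
      refine e2.trans (mul_le_mul_of_nonneg_left ?_ hL0); linarith [le_abs_self (ε (φ n))]
    have hLρ : L * (2 * ρ) ≤ e / 4 := by
      calc L * (2 * ρ) ≤ L * (2 * (e / (8 * (L + 1)))) := by gcongr
        _ = (L / (L + 1)) * (e / 4) := by field_simp; ring
        _ ≤ 1 * (e / 4) := by
            refine mul_le_mul_of_nonneg_right ?_ (by positivity)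
            rw [div_le_one (by positivity)]; linarith
        _ = e / 4 := one_mul _
    calc dist (u (φ m) x) (u (φ n) x)
        ≤ dist (u (φ m) x) (u (φ m) (q (jof z))) + dist (u (φ m) (q (jof z))) (u (φ n) x) := dist_triangle _ _ _
      _ ≤ dist (u (φ m) x) (u (φ m) (q (jof z))) +
          (dist (u (φ m) (q (jof z))) (u (φ n) (q (jof z))) + dist (u (φ n) (q (jof z))) (u (φ n) x)) := by
          gcongr; exact dist_triangle _ _ _
      _ < e / 4 + (e / 4 + e / 4) := by
          refine add_lt_add_of_le_of_lt (b1.trans hLρ) (add_lt_add_of_lt_of_le e3 ?_)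
          rw [dist_comm]; exact b2.trans hLρ
      _ < e := by linarith
  -- pointwise limits on `D`
  have hpt : ∀ z ∈ D, CauchySeq fun k => u (φ k) z := by
    intro z hz
    have := hUC {z} (singleton_subset_iff.2 hz) isCompact_singleton
    rw [Metric.uniformCauchySeqOn_iff] at this
    rw [Metric.cauchySeq_iff]
    intro e he
    obtain ⟨N, hN⟩ := this e he
    exact ⟨N, fun m hm n hn => hN m hm n hn z (mem_singleton z)⟩
  set g : ℂ → ℂ := fun z => limUnder atTop fun k => u (φ k) z with hg
  have hglim : ∀ z ∈ D, Tendsto (fun k => u (φ k) z) atTop (𝓝 (g z)) := by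
    intro z hz
    obtain ⟨l, hl⟩ := cauchySeq_tendsto_of_complete (hpt z hz)
    rw [hg]; simp only
    rwa [hl.limUnder_eq]
  refine ⟨φ, hφ, g, ?_, fun K hKD hK => (hUC K hKD hK).tendstoUniformlyOn_of_tendsto fun z hz => hglim z (hKD hz)⟩
  -- continuity of the limit
  intro z₀ hz₀
  obtain ⟨r, hr, hrD⟩ := (isCompact_singleton (x := z₀)).exists_cthickening_subset_open hD (singleton_subset_iff.2 hz₀)
  rw [cthickening_singleton _ hr.le] at hrD
  obtain ⟨L, hL0, hL⟩ := hequi (closedBall z₀ r) hrD (isCompact_closedBall _ _)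
  rw [Metric.continuousWithinAt_iff]
  intro e he
  refine ⟨min r (e / (L + 1)), lt_min hr (by positivity), fun z hzD hzd => ?_⟩
  have hzr : z ∈ closedBall z₀ r := mem_closedBall.2 (le_of_lt (lt_of_lt_of_le hzd (min_le_left _ _)))
  have hz₀r : z₀ ∈ closedBall z₀ r := mem_closedBall_self hr.le
  -- pass to the limit in `‖u_k z - u_k z₀‖ ≤ L (‖z - z₀‖ + ε_k)`
  have hlim2 : Tendsto (fun k => ‖u (φ k) z - u (φ k) z₀‖) atTop (𝓝 ‖g z - g z₀‖) :=
    ((hglim z hzD).sub (hglim z₀ hz₀)).norm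
  have hlim3 : Tendsto (fun k => L * (‖z - z₀‖ + ε (φ k))) atTop (𝓝 (L * (‖z - z₀‖ + 0))) :=
    (tendsto_const_nhds.add (hε.comp hφt)).const_mul L
  have hle : ‖g z - g z₀‖ ≤ L * (‖z - z₀‖ + 0) :=
    le_of_tendsto_of_tendsto hlim2 hlim3 (hφt.eventually hL |>.mono fun k hk => hk z hzr z₀ hz₀r)
  rw [add_zero] at hle
  rw [dist_eq_norm]
  have hzd' : ‖z - z₀‖ < e / (L + 1) := by rw [← dist_eq_norm]; exact lt_of_lt_of_le hzd (min_le_right _ _)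
  calc ‖g z - g z₀‖ ≤ L * ‖z - z₀‖ := hle
    _ ≤ (L + 1) * ‖z - z₀‖ := by nlinarith [norm_nonneg (z - z₀)]
    _ < (L + 1) * (e / (L + 1)) := by gcongr
    _ = e := by field_simp

/-! ### Riemann sums of continuous functions -/

/-- **Left Riemann sums.** If `‖f s - f t‖ ≤ ω` whenever `s, t ∈ [a, a + N h]` are within `h` of
each other (`h ≥ 0`) and `f` is continuous there, then
`‖∑_{k<N} h • f(a + k h) - ∫_a^{a+Nh} f‖ ≤ N h ω`. [folklore] -/
theorem norm_sum_smul_sub_integral_le {f : ℝ → ℂ} {a h ω : ℝ} {N : ℕ} (hh : 0 ≤ h)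
    (hf : ContinuousOn f (Icc a (a + N * h)))
    (hω : ∀ s ∈ Icc a (a + N * h), ∀ t ∈ Icc a (a + N * h), |s - t| ≤ h → ‖f s - f t‖ ≤ ω) :
    ‖(∑ k ∈ Finset.range N, (h : ℂ) * f (a + k * h)) - ∫ x in a..(a + N * h), f x‖ ≤ N * h * ω := by
  -- split the integral at the points `a + k h`
  have hmono : ∀ k : ℕ, k ≤ N → a + k * h ≤ a + N * h := fun k hk => by
    have : (k : ℝ) ≤ N := by exact_mod_cast hk
    nlinarith
  have hint : ∀ k < N, IntervalIntegrable f MeasureTheory.volume (a + k * h) (a + (k + 1 : ℕ) * h) := by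
    intro k hk
    refine (hf.mono ?_).intervalIntegrable
    rw [uIcc_of_le (by push_cast; nlinarith)]
    exact Icc_subset_Icc (by nlinarith) (hmono (k + 1) hk)
  have hsplit := intervalIntegral.sum_integral_adjacent_intervals (f := f) (μ := MeasureTheory.volume)
    (a := fun k : ℕ => a + k * h) (n := N) hint
  simp only [Nat.cast_zero, zero_mul, add_zero] at hsplit
  rw [← hsplit, ← Finset.sum_sub_distrib]
  calc ‖∑ k ∈ Finset.range N, ((h : ℂ) * f (a + k * h) - ∫ x in (a + k * h)..(a + (k + 1 : ℕ) * h), f x)‖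
      ≤ ∑ k ∈ Finset.range N, ‖(h : ℂ) * f (a + k * h) - ∫ x in (a + k * h)..(a + (k + 1 : ℕ) * h), f x‖ :=
        norm_sum_le _ _
    _ ≤ ∑ k ∈ Finset.range N, h * ω := by
        refine Finset.sum_le_sum fun k hk => ?_
        have hkN := Finset.mem_range.1 hk
        have hlen : a + (k + 1 : ℕ) * h - (a + k * h) = h := by push_cast; ring
        -- `h • f(a + kh) = ∫ const`
        have hconst : (h : ℂ) * f (a + k * h) = ∫ _ in (a + k * h)..(a + (k + 1 : ℕ) * h), f (a + k * h) := by
          rw [intervalIntegral.integral_const, hlen, Complex.real_smul]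
        rw [hconst, ← intervalIntegral.integral_sub intervalIntegrable_const (hint k hkN)]
        have hle : a + k * h ≤ a + (k + 1 : ℕ) * h := by push_cast; nlinarith
        calc ‖∫ x in (a + k * h)..(a + (k + 1 : ℕ) * h), (f (a + k * h) - f x)‖
            ≤ ω * |a + (k + 1 : ℕ) * h - (a + k * h)| := by
              refine intervalIntegral.norm_integral_le_of_norm_le_const fun x hx => ?_
              rw [uIoc_of_le hle] at hx
              have hxI : x ∈ Icc a (a + N * h) :=
                ⟨by nlinarith [hx.1, (show (0:ℝ) ≤ k from Nat.cast_nonneg k)], hx.2.trans (hmono (k + 1) hkN)⟩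
              have hkI : a + k * h ∈ Icc a (a + N * h) :=
                ⟨by nlinarith [(show (0:ℝ) ≤ k from Nat.cast_nonneg k)], hmono k hkN.le⟩
              rw [norm_sub_rev]
              refine hω x hxI _ hkI ?_
              rw [abs_le]; constructor <;> [linarith [hx.1]; (push_cast at hx; linarith [hx.2])]
          _ = h * ω := by rw [hlen, abs_of_nonneg hh]; ring
    _ = N * h * ω := by rw [Finset.sum_const, Finset.card_range, nsmul_eq_mul]; ring

/-- Moving the upper limit of an interval integral of a bounded function. [folklore] -/
theorem norm_integral_sub_integral_le {f : ℝ → ℂ} {a b c M : ℝ}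
    (hf : IntervalIntegrable f MeasureTheory.volume a b) (hf' : IntervalIntegrable f MeasureTheory.volume b c)
    (hM : ∀ x ∈ uIoc b c, ‖f x‖ ≤ M) :
    ‖(∫ x in a..c, f x) - ∫ x in a..b, f x‖ ≤ M * |c - b| := by
  rw [← intervalIntegral.integral_add_adjacent_intervals hf hf', add_sub_cancel_left]
  exact intervalIntegral.norm_integral_le_of_norm_le_const hM

/-! ### From subsequences to locally uniform convergence along `𝓝[>] 0` -/

/-- **Subsequence principle for locally uniform convergence.** If every sequence `δ_n → 0⁺` has a
subsequence along which `F (δ_n)` converges to `g` uniformly on each compact subset of the open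
set `D`, then `F δ → g` locally uniformly on `D` as `δ → 0⁺`. [folklore] -/
theorem tendstoLocallyUniformlyOn_of_forall_seq {D : Set ℂ} (hD : IsOpen D) {F : ℝ → ℂ → ℂ} {g : ℂ → ℂ}
    (h : ∀ s : ℕ → ℝ, Tendsto s atTop (𝓝[>] (0 : ℝ)) → ∃ φ : ℕ → ℕ, StrictMono φ ∧
      ∀ K ⊆ D, IsCompact K → TendstoUniformlyOn (fun k => F (s (φ k))) g atTop K) :
    TendstoLocallyUniformlyOn F g (𝓝[>] (0 : ℝ)) D := by
  rw [tendstoLocallyUniformlyOn_iff_forall_isCompact hD]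
  intro K hKD hK
  rw [Metric.tendstoUniformlyOn_iff]
  intro ε hε
  rw [Filter.eventually_iff_seq_eventually]
  intro s hs
  by_contra hnot
  rw [Filter.not_eventually] at hnot
  obtain ⟨ψ, hψ, hbad⟩ := Filter.extraction_of_frequently_atTop hnot
  obtain ⟨φ, hφ, hconv⟩ := h (s ∘ ψ) (hs.comp hψ.tendsto_atTop)
  have := (Metric.tendstoUniformlyOn_iff.1 (hconv K hKD hK)) ε hε
  obtain ⟨k, hk⟩ := this.exists
  exact hbad (φ k) hk

end Literature.Probability.LatticeModels
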